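import Summits.BirchSwinnertonDyer.Rank1Residual.Additive.QuadraticBranchMazurTateThreeTerm
import Literature.NumberTheory.EllipticCurves.PAdicLFunctionInvolutionProofs
import HarnessLib

/-!
# Dirichlet characters of order `2pⁿ` modulo `p^{n+1}` (`ψ = ηχ`) and the values of the
# quadratic-branch Mazur–Tate element: `θ_n(f, η)(ψ(γ) − 1) = ∑_a ψ(a)[a/p^{n+1}]^δ_f`,
# `θ_1(f, η)(0) = 0` (proofs only), file 4 of 5 towards the EXISTENCE of Kobayashi's `L_p⁻(V, η, X)`

HONEST FRAMING (cell `bsd-potss`, run/shared/lean/pub/bsd-potss/, FULL-BSD rank ≤ 1 programme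
tranche 1b, human ruling D-0036; seat `bsd-potss-ctrl` = "signed control along the quadratic branch"):
the programme's target of record is FULL BSD for every analytic-rank ≤ 1 curve over `ℚ`; this seat's
object is the quadratic (`η = ω^{(p−1)/2}`) branch of Kobayashi's signed theory for the good
`a_p = 0` twin `V` of an additive potentially supersingular curve `W = V ⊗ η` (classes Gss2 / O5 `e = 2`,
O10-PS). THIS FILE: THEOREMS ONLY (no definition, no `sorry`); NOTHING about `BSD(W, p)`, (C1_η), (C2_η-GZ) or (C3_η) of any pair is claimed
or moved; no named Literature fact is introduced; axioms standard.

## Contents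

For `p` odd and `ψ` a Dirichlet character modulo `p^{n+e₀} = p^{n+1}` with values in `ℂ_p` of ORDER
`2pⁿ` — exactly the characters of Kobayashi's (3.4)/(3.5), `ψ = ηχ` with `χ` of conductor `p^{n+1}`:
* `apply_toZModPow_eq_teichSign`: `ψ(w) = η(w) = w^{(p−1)/2}` on the Teichmüller representatives (the
  values are `(p−1)`-th and `2pⁿ`-th roots of unity, so `±1`, not all `1` since `ψ` does not factor
  through `Γ/Γ^{pⁿ}`, and `μ_{p−1}(ℤ_p)` is generated by a primitive root);
* `orderOf_apply_cyclotomicGenerator_of_orderOf_eq`: `ζ = ψ(γ)` is a PRIMITIVE `pⁿ`-th root of unity;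
* `eval₂_quadraticBranchMazurTateElement_eq`: `θ_n(η)(ζ − 1)` is Birch's twisted symbol sum
  (`ratTwistedSymbolSum` / `ratMinusTwistedSymbolSum` by the parity of `η`);
* `eval_zero_quadraticBranchMazurTateElement_one`: `θ_1(η)(0) = −[0]^δ_f ∑_w η(w) = 0` — Kobayashi's
  (3.7) "`L_p⁻(E, η, 0) = 0`" at the level of the modular element.

References: [Kobayashi2003] §3 (pp. 5–7), (3.4)–(3.7); [MazurTateTeitelbaum1986Invent] §I.13;
[Washington1997] §7.2 (`ℤ_p^× = μ_{p−1} × (1 + pℤ_p)`).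
-/

noncomputable section

open scoped Classical MatrixGroups ModularForm

open CongruenceSubgroup Polynomial Literature.NumberTheory.EllipticCurves
  Literature.NumberTheory.EllipticCurves.ModularForms

namespace Summit.BirchSwinnertonDyer.Rank1Residual.Additive

/-! ## §6 Dirichlet characters of order `2pⁿ` modulo `p^{n+1}` -/

section Characters

variable (p : ℕ) [hp : Fact p.Prime]

/-- `η(w^i) = η(w)^i`. [folklore] -/
theorem teichSign_pow (hp2 : p ≠ 2) (w : rootsOfUnity (torsionOrder p) ℤ_[p]) (i : ℕ) :
    teichSign p (w ^ i) = teichSign p w ^ i := by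
  have h := cast_teichSign_eq_pow p hp2 (w ^ i)
  rw [Subgroup.coe_pow, Units.val_pow_eq_pow_val, ← pow_mul, mul_comm, pow_mul,
    ← cast_teichSign_eq_pow p hp2 w, ← Int.cast_pow] at h
  exact_mod_cast (Int.cast_injective (α := ℤ_[p])) h

/-- Every Teichmüller representative is a power of a primitive `(p−1)`-th root of unity `ζ ∈ ℤ_p`.
[folklore] -/
theorem exists_pow_eq_of_isPrimitiveRoot {ζ : ℤ_[p]} (hζ : IsPrimitiveRoot ζ (torsionOrder p))
    (w : rootsOfUnity (torsionOrder p) ℤ_[p]) :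
    ∃ i : ℕ, haveI := neZero_torsionOrder p; hζ.toRootsOfUnity ^ i = w := by
  haveI := neZero_torsionOrder p
  obtain ⟨i, -, hi⟩ := hζ.eq_pow_of_pow_eq_one (rootsOfUnity_pow_torsionOrder p w)
  refine ⟨i, Subtype.ext (Units.ext ?_)⟩
  rw [Subgroup.coe_pow, Units.val_pow_eq_pow_val]
  simpa using hi

/-- A primitive `(p−1)`-th root of unity has `η = −1` (odd `p`). [folklore] -/
theorem teichSign_toRootsOfUnity_eq_neg_one (hp2 : p ≠ 2) {ζ : ℤ_[p]}
    (hζ : IsPrimitiveRoot ζ (torsionOrder p)) :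
    haveI := neZero_torsionOrder p; teichSign p hζ.toRootsOfUnity = -1 := by
  haveI := neZero_torsionOrder p
  have hτ2 : 2 ≤ torsionOrder p := by
    rw [torsionOrder_eq, if_neg hp2]
    have := hp.out.two_le
    rcases hp.out.eq_two_or_odd with h | h
    · exact absurd h hp2
    · omega
  unfold teichSign
  rw [if_neg]
  intro h1
  have hval : ((hζ.toRootsOfUnity : ℤ_[p]ˣ) : ℤ_[p]) = ζ := by simp
  rw [hval] at h1
  have h2 := hζ.dvd_of_pow_eq_one _ h1
  have h3 : 0 < torsionOrder p / 2 := Nat.div_pos hτ2 two_pos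
  have h4 := Nat.le_of_dvd h3 h2
  omega

variable {p}

/-- `γ` is killed by `pⁿ`-th powers of any character modulo `p^{n+e₀}`: `ψ(γ)^{pⁿ} = 1`. [folklore] -/
theorem apply_cyclotomicGenerator_pow_eq_one {n : ℕ}
    (ψ : DirichletCharacter ℂ_[p] (p ^ (n + cyclotomicExponent p))) :
    ψ (cyclotomicGenerator p : ZMod (p ^ (n + cyclotomicExponent p))) ^ p ^ n = 1 := by
  rw [← map_pow, ← orderOf_cyclotomicGenerator p n, pow_orderOf_eq_one, map_one]

/-- **A character of order `2pⁿ` modulo `p^{n+1}` restricted to the Teichmüller representatives IS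
the quadratic character `η`**: `ψ(w mod p^{n+1}) = η(w) = w^{(p−1)/2}` (odd `p`). Indeed the values
`ψ(w)` are `(p−1)`-th and `2pⁿ`-th roots of unity, hence `±1`; they are not all `1` (else `ψ` would
factor through `Γ/Γ^{pⁿ}` and have order dividing `pⁿ`), and `μ_{p−1}(ℤ_p)` is cyclic.
[cite: Kobayashi2003, §3 (3.4)–(3.5) (p. 7: ψ = ηχ)] [cite: MazurTateTeitelbaum1986Invent, §I.13] -/
theorem apply_toZModPow_eq_teichSign (hp2 : p ≠ 2) {n : ℕ}
    (ψ : DirichletCharacter ℂ_[p] (p ^ (n + cyclotomicExponent p))) (hψ : orderOf ψ = 2 * p ^ n)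
    (w : rootsOfUnity (torsionOrder p) ℤ_[p]) :
    ψ (PadicInt.toZModPow (n + cyclotomicExponent p) ((w : ℤ_[p]ˣ) : ℤ_[p])) =
      ((teichSign p w : ℤ) : ℂ_[p]) := by
  classical
  have hP : p.Prime := hp.out
  haveI := neZero_torsionOrder p
  haveI : NeZero (p ^ (n + cyclotomicExponent p)) := ⟨pow_ne_zero _ hP.ne_zero⟩
  set φ : rootsOfUnity (torsionOrder p) ℤ_[p] → ℂ_[p] := fun w ↦
    ψ (PadicInt.toZModPow (n + cyclotomicExponent p) ((w : ℤ_[p]ˣ) : ℤ_[p])) with hφ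
  -- `φ` is multiplicative and `φ(w^i) = φ(w)^i`
  have hφpow : ∀ (w : rootsOfUnity (torsionOrder p) ℤ_[p]) (i : ℕ), φ (w ^ i) = φ w ^ i := by
    intro w i
    simp only [hφ, Subgroup.coe_pow, Units.val_pow_eq_pow_val, map_pow]
  -- the values of `φ` are `±1`
  have hval : ∀ w : rootsOfUnity (torsionOrder p) ℤ_[p], φ w = 1 ∨ φ w = -1 := by
    intro w
    have hu : IsUnit (PadicInt.toZModPow (n + cyclotomicExponent p) ((w : ℤ_[p]ˣ) : ℤ_[p])) :=
      (Units.isUnit _).map _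
    obtain ⟨v, hv⟩ := hu
    have h1 : φ w ^ torsionOrder p = 1 := by
      rw [← hφpow]
      simp only [hφ]
      have : ((w ^ torsionOrder p : rootsOfUnity (torsionOrder p) ℤ_[p]) : ℤ_[p]ˣ) = 1 := by
        rw [Subgroup.coe_pow]
        exact_mod_cast (mem_rootsOfUnity _ _).mp w.2
      rw [this, Units.val_one, map_one, map_one]
    have h2 : φ w ^ (2 * p ^ n) = 1 := by
      simp only [hφ]
      rw [← hv, ← MulChar.pow_apply_coe, ← hψ, pow_orderOf_eq_one, MulChar.one_apply_coe]
    have hτ : torsionOrder p = p - 1 := by rw [torsionOrder_eq, if_neg hp2]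
    have hcop : Nat.Coprime (p ^ n) (torsionOrder p) := by
      rw [hτ]
      exact Nat.Coprime.pow_left n ((Nat.coprime_self_sub_right hP.one_le).mpr
        (Nat.coprime_one_right p))
    have hev : 2 ∣ torsionOrder p := by
      rw [hτ]; rcases hP.eq_two_or_odd with h | h
      · exact absurd h hp2
      · omega
    have hg : Nat.gcd (torsionOrder p) (2 * p ^ n) = 2 := by
      rw [hcop.gcd_mul_right_cancel_right, Nat.gcd_eq_right hev]
    have h := pow_gcd_eq_one.mpr ⟨h1, h2⟩
    rw [hg, pow_two] at h
    exact mul_self_eq_one_iff.mp h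
  -- `γ` contributes `pⁿ`-th roots of unity
  have hγn := apply_cyclotomicGenerator_pow_eq_one (p := p) ψ
  -- `φ` is not identically `1`
  have hne : ∃ w : rootsOfUnity (torsionOrder p) ℤ_[p], φ w ≠ 1 := by
    by_contra hall
    simp only [not_exists, not_not] at hall
    have hpow : ψ ^ p ^ n = 1 := by
      refine MulChar.ext fun u ↦ ?_
      obtain ⟨w, s, hws⟩ := exists_classMap_eq_of_isUnit p n u.isUnit
      rw [MulChar.pow_apply_coe, MulChar.one_apply_coe, ← hws, map_mul, map_pow, mul_pow]
      have h1 : φ w = 1 := hall w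
      simp only [hφ] at h1
      rw [h1, one_pow, one_mul, ← pow_mul, mul_comm, pow_mul, hγn, one_pow]
    have hdvd := orderOf_dvd_of_pow_eq_one hpow
    rw [hψ] at hdvd
    have h1 := Nat.le_of_dvd (pow_pos hP.pos n) hdvd
    have h2 : 0 < p ^ n := pow_pos hP.pos n
    omega
  -- a generator `ζ` of `μ_{p−1}` has `φ(ζ) = −1 = η(ζ)`; conclude on powers
  obtain ⟨ζ, hζ⟩ := exists_isPrimitiveRoot_torsionOrder p
  set g : rootsOfUnity (torsionOrder p) ℤ_[p] := hζ.toRootsOfUnity with hg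
  have hφg : φ g = -1 := by
    rcases hval g with h | h
    · exfalso
      obtain ⟨w₁, hw₁⟩ := hne
      obtain ⟨i, rfl⟩ := exists_pow_eq_of_isPrimitiveRoot p hζ w₁
      exact hw₁ (by rw [← hg, hφpow, h, one_pow])
    · exact h
  have hsg : teichSign p g = -1 := teichSign_toRootsOfUnity_eq_neg_one p hp2 hζ
  obtain ⟨i, rfl⟩ := exists_pow_eq_of_isPrimitiveRoot p hζ w
  change φ (g ^ i) = _
  rw [hφpow, hφg, teichSign_pow p hp2, hsg]
  push_cast
  rfl

/-- **`ψ(γ)` has order exactly `pⁿ`** for `ψ` of order `2pⁿ` modulo `p^{n+1}` (odd `p`): its order is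
`p^k`, `k ≤ n`, and `ψ^{2p^k} = 1` on `μ_{p−1} × ⟨γ⟩ = (ℤ/p^{n+1})^×`. Hence `ζ = ψ(γ)` is a
PRIMITIVE `pⁿ`-th root of unity — the `ζ` of Kobayashi's (3.4)/(3.5). [cite: Kobayashi2003, §3 (p. 7)]
[cite: MazurTateTeitelbaum1986Invent, §I.13] -/
theorem orderOf_apply_cyclotomicGenerator_of_orderOf_eq (hp2 : p ≠ 2) {n : ℕ}
    (ψ : DirichletCharacter ℂ_[p] (p ^ (n + cyclotomicExponent p))) (hψ : orderOf ψ = 2 * p ^ n) :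
    orderOf (ψ (cyclotomicGenerator p : ZMod (p ^ (n + cyclotomicExponent p)))) = p ^ n := by
  classical
  have hP : p.Prime := hp.out
  haveI : NeZero (p ^ (n + cyclotomicExponent p)) := ⟨pow_ne_zero _ hP.ne_zero⟩
  have hγn := apply_cyclotomicGenerator_pow_eq_one (p := p) ψ
  obtain ⟨k, hk, hord⟩ := (Nat.dvd_prime_pow hP).mp (orderOf_dvd_of_pow_eq_one hγn)
  rcases hk.lt_or_eq with hlt | heq
  · exfalso
    have hpow : ψ ^ (2 * p ^ k) = 1 := by
      refine MulChar.ext fun u ↦ ?_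
      obtain ⟨w, s, hws⟩ := exists_classMap_eq_of_isUnit p n u.isUnit
      rw [MulChar.pow_apply_coe, MulChar.one_apply_coe, ← hws, map_mul, map_pow, mul_pow,
        apply_toZModPow_eq_teichSign hp2 ψ hψ w]
      have hts : ((teichSign p w : ℤ) : ℂ_[p]) ^ (2 * p ^ k) = 1 := by
        rw [pow_mul]
        rcases teichSign_eq_one_or p w with h | h <;> simp [h]
      have hγ' : (ψ (cyclotomicGenerator p : ZMod (p ^ (n + cyclotomicExponent p))) ^ s.val) ^
          (2 * p ^ k) = 1 := by
        rw [← pow_mul, show s.val * (2 * p ^ k) = p ^ k * (2 * s.val) by ring, pow_mul, ← hord,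
          pow_orderOf_eq_one, one_pow]
      rw [hts, hγ', one_mul]
    have hdvd := orderOf_dvd_of_pow_eq_one hpow
    rw [hψ] at hdvd
    have h1 : p ^ n ∣ p ^ k := Nat.dvd_of_mul_dvd_mul_left two_pos hdvd
    have h2 := (Nat.pow_dvd_pow_iff_le_right hP.one_lt).mp h1
    omega
  · rw [hord, heq]

end Characters

/-! ## §7 Evaluation of `θ_n(η)` at `ψ(γ) − 1` and at `0` -/

section Evaluation

variable {N : ℕ} (f : CuspForm (Gamma0 N) 2) {p : ℕ} [hp : Fact p.Prime]

/-- **The value of `θ_n(η)` at a character of order `2pⁿ` is Birch's twisted symbol sum**: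
`θ_n(η)(ψ(γ) − 1) = ∑_{a mod p^{n+1}} ψ(a) [a/p^{n+1}]^δ_f` (`= ratTwistedSymbolSum f ψ` for
`p ≡ 1 (mod 4)`, `ratMinusTwistedSymbolSum f ψ` for `p ≡ 3 (mod 4)`): `(1+T)^s ↦ ψ(γ)^s`,
`η(w)ψ(γ)^s = ψ(wγ^s)` (`apply_toZModPow_eq_teichSign`), and `(w, s) ↦ wγ^s` is a bijection onto the
units; non-units contribute `ψ(a) = 0`. [cite: Kobayashi2003, (3.4)–(3.5) (p. 7)]
[cite: MazurTateTeitelbaum1986Invent, §I.13] -/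
theorem eval₂_quadraticBranchMazurTateElement_eq (hp2 : p ≠ 2) {n : ℕ}
    (ψ : DirichletCharacter ℂ_[p] (p ^ (n + cyclotomicExponent p))) (hψ : orderOf ψ = 2 * p ^ n) :
    (quadraticBranchMazurTateElement p f n).eval₂ (algebraMap ℚ ℂ_[p])
        (ψ (cyclotomicGenerator p : ZMod (p ^ (n + cyclotomicExponent p))) - 1) =
      if Even (p / 2) then ratTwistedSymbolSum f ψ else ratMinusTwistedSymbolSum f ψ := by
  classical
  have hP : p.Prime := hp.out
  haveI := neZero_torsionOrder p
  haveI := Fintype.ofFinite (rootsOfUnity (torsionOrder p) ℤ_[p])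
  haveI : NeZero (p ^ n) := ⟨pow_ne_zero _ hP.ne_zero⟩
  haveI : NeZero (p ^ (n + cyclotomicExponent p)) := ⟨pow_ne_zero _ hP.ne_zero⟩
  set g : ZMod (p ^ (n + cyclotomicExponent p)) → ℂ_[p] := fun b ↦
    ψ b * algebraMap ℚ ℂ_[p]
      (branchSymbol p f ((b.val : ℚ) / (p : ℚ) ^ (n + cyclotomicExponent p))) with hg
  have h1 : (quadraticBranchMazurTateElement p f n).eval₂ (algebraMap ℚ ℂ_[p])
      (ψ (cyclotomicGenerator p : ZMod (p ^ (n + cyclotomicExponent p))) - 1) =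
      ∑ᶠ w : rootsOfUnity (torsionOrder p) ℤ_[p], ∑ s : ZMod (p ^ n),
        g (PadicInt.toZModPow (n + cyclotomicExponent p) ((w : ℤ_[p]ˣ) : ℤ_[p]) *
          (cyclotomicGenerator p : ZMod (p ^ (n + cyclotomicExponent p))) ^ s.val) := by
    rw [quadraticBranchMazurTateElement, finsum_eq_sum_of_fintype, finsum_eq_sum_of_fintype,
      eval₂_finsetSum]
    refine Finset.sum_congr rfl fun w _ ↦ ?_
    rw [eval₂_finsetSum]
    refine Finset.sum_congr rfl fun s _ ↦ ?_
    rw [eval₂_mul, eval₂_C, eval₂_pow, eval₂_add, eval₂_X, eval₂_one, sub_add_cancel, hg]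
    dsimp only
    rw [map_mul ψ, map_pow ψ, apply_toZModPow_eq_teichSign hp2 ψ hψ w, map_mul (algebraMap ℚ ℂ_[p]),
      map_intCast]
    ring
  rw [h1, finsum_sum_classes_eq_sum_units p n g, sum_units_eq_sum_filter_isUnit, Finset.sum_filter]
  unfold ratTwistedSymbolSum ratMinusTwistedSymbolSum
  split_ifs with hev
  · refine Finset.sum_congr rfl fun a _ ↦ ?_
    split_ifs with ha
    · rw [hg]
      dsimp only
      rw [branchSymbol, if_pos hev, eq_ratCast, Nat.cast_pow]
    · rw [MulChar.map_nonunit ψ ha, zero_mul]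
  · refine Finset.sum_congr rfl fun a _ ↦ ?_
    split_ifs with ha
    · rw [hg]
      dsimp only
      rw [branchSymbol, if_neg hev, eq_ratCast, Nat.cast_pow]
    · rw [MulChar.map_nonunit ψ ha, zero_mul]

variable [NeZero N]

/-- **`θ_1(η)` vanishes at `T = 0`** (`a_p = 0`, odd `p`): `θ_1(η)(0) = ∑_w η(w) ∑_{s<p} [wγ^s/p²]^δ
= −∑_w η(w)[w]^δ = −[0]^δ_f · ∑_w η(w) = 0` (the `s`-sum is a fibre sum of the Hecke relation; the
symbol is invariant under integer translation; `∑ η = 0`). This is Kobayashi's (3.7) "`L_p⁻(E,η,0) = 0`"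
at the level of the modular element. [cite: Kobayashi2003, (3.7) (p. 7)]
[cite: MazurTateTeitelbaum1986Invent, §I.10 Prop. (10.2)] -/
theorem eval_zero_quadraticBranchMazurTateElement_one (hp2 : p ≠ 2) (hf0 : IsNewform0 f)
    (hQ : coeffField f = ⊥) (hpN : ¬ p ∣ N) (hap : cuspCoeff f p = ((0 : ℤ) : ℂ)) :
    (quadraticBranchMazurTateElement p f 1).eval 0 = 0 := by
  classical
  have hP : p.Prime := hp.out
  haveI := neZero_torsionOrder p
  haveI := Fintype.ofFinite (rootsOfUnity (torsionOrder p) ℤ_[p])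
  have he : cyclotomicExponent p = 1 := if_neg hp2
  have hL : 1 + cyclotomicExponent p = cyclotomicExponent p + 1 := by omega
  have hdvd : p ^ cyclotomicExponent p ∣ p ^ (1 + cyclotomicExponent p) := pow_dvd_pow p (by omega)
  have hδ : orderOf (cyclotomicGenerator p : ZMod (p ^ (1 + cyclotomicExponent p))) = p := by
    rw [orderOf_cyclotomicGenerator p 1, pow_one]
  have hδ1 : ZMod.castHom hdvd (ZMod (p ^ cyclotomicExponent p))
      (cyclotomicGenerator p : ZMod (p ^ (1 + cyclotomicExponent p))) = 1 := by
    rw [map_natCast, cyclotomicGenerator_cast_cyclotomicExponent]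
  have h := map_quadraticBranchMazurTateElement_eq (p := p) (f := f) (Polynomial.evalRingHom (0 : ℚ)) 1
  rw [Polynomial.coe_evalRingHom] at h
  rw [h, pow_one]
  have hw : ∀ w : rootsOfUnity (torsionOrder p) ℤ_[p],
      ∑ k ∈ Finset.range p, eval 0 (C ((teichSign p w : ℚ) * branchSymbol p f
        (((PadicInt.toZModPow (1 + cyclotomicExponent p) ((w : ℤ_[p]ˣ) : ℤ_[p]) *
            (cyclotomicGenerator p : ZMod (p ^ (1 + cyclotomicExponent p))) ^ k).val : ℚ) /
          (p : ℚ) ^ (1 + cyclotomicExponent p)))) * eval 0 (X + 1) ^ k =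
      (teichSign p w : ℚ) * -branchSymbol p f 0 := by
    intro w
    have hb₀ : IsUnit (PadicInt.toZModPow (1 + cyclotomicExponent p) ((w : ℤ_[p]ˣ) : ℤ_[p])) :=
      (Units.isUnit _).map _
    have horb := sum_range_branchSymbol_orbit_eq_neg hf0 hQ hpN hap hL hdvd hb₀ hδ hδ1
    simp only [eval_C, eval_add, eval_X, eval_one, zero_add, one_pow, mul_one]
    rw [← Finset.mul_sum, horb]
    congr 2
    -- `p · a/p^{e₀} = a ∈ ℕ` and `[a]^δ = [0]^δ`
    set a := ZMod.castHom hdvd (ZMod (p ^ cyclotomicExponent p))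
      (PadicInt.toZModPow (1 + cyclotomicExponent p) ((w : ℤ_[p]ˣ) : ℤ_[p])) with ha
    have hp0 : (p : ℚ) ≠ 0 := Nat.cast_ne_zero.mpr hP.ne_zero
    have hpe : (p : ℚ) ^ cyclotomicExponent p = p := by rw [he, pow_one]
    have h1 : (p : ℚ) * ((a.val : ℚ) / (p : ℚ) ^ cyclotomicExponent p) = (0 : ℚ) + ((a.val : ℤ) : ℚ) := by
      rw [hpe, Int.cast_natCast, zero_add, mul_div_cancel₀ _ hp0]
    rw [h1, branchSymbol_add_intCast]
  simp_rw [hw]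
  rw [← Finset.sum_mul, sum_teichSign_eq_zero p hp2, zero_mul]

end Evaluation

end Summit.BirchSwinnertonDyer.Rank1Residual.Additive

end
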